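import Mathlib
import Literature.Computability.AlgebraicComplexity.NestFreeMatchingPoly
import Summits.ValiantsHypothesis.ValiantsHypothesis.Theorems.FifoMatchingNNDivisionHardStackPowersQueue
import Summits.ValiantsHypothesis.ValiantsHypothesis.Theorems.FifoMatchingNNDivisionHardSplitFaceDefs
import HarnessLib

/-!
# Route FifoMatching — crux `NNDivisionHard` (stmt-ValiantsHypothesis-21181): the SPLIT FACE of the nest-free matching
# polynomial, I — block-stable matchings are two-sided gluings

For block sizes `b, c` (ambient `[0, 2(b+c))`, left block `L = [0, 2b)`, right block `R = [2b, 2(b+c))`) and the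
left-internal direction `w = 𝟙_L = SplitFace.lWeight b c` (weight `1` on the arc variables with both ends in `L`):

* `weight_eq_card`, `two_mul_card_filter_le`, `weight_le`, `weight_eq_iff` — a perfect matching has `w`-weight `≤ b`,
  with equality iff it STABILISES the left block (`i < 2b → M i < 2b`);
* `restrictM_mem'`, `restrictR_mem`, `glue2_mem`, `restrictM_glue2`, `restrictR_glue2`, `glue2_restrict` — the block-stable
  nest-free perfect matchings of `[0, 2(b+c))` are exactly the two-sided gluings `glue2 NL NR` of nest-free perfect
  matchings `NL` of `[0, 2b)` and `NR` of `[0, 2c)` (bijectively: `restrictM`, `restrictR` invert `glue2`).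

Sequel: `…NNDivisionHardSplitFace` (the face `top_{𝟙_L}(NN_{b+c}) = ι_L(NN_b) · ι_R(NN_c)`, prefix / suffix transport).
HONEST FRAMING: `Fin` combinatorics only; nothing here bears on the crux, on `NNNotVP` or on VP ≠ VNP (NOT proved).
References: Chen–Deng–Du–Stanley–Yan 2007 §1 [ChenDengDuStanleyYan2007].
-/

noncomputable section

-- Sub = Summit single-conjunct layout: the duplicated namespace component is mandated by the tree.
set_option linter.dupNamespace false
set_option autoImplicit false

namespace Summit.ValiantsHypothesis.ValiantsHypothesis.Theorems.FifoMatching.NNDivisionHard.SplitFace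

open Finset Literature.Computability.AlgebraicComplexity
open Summit.ValiantsHypothesis.ValiantsHypothesis.Theorems.FifoMatching.NNDivisionHard.StackPowersQueue
  (restrictM val_restrictM filter_lt_eq_map)
open Summit.ValiantsHypothesis.ValiantsHypothesis.Theorems.FifoMatching.NNDivisionHard.StackPowers
  (weight_arcExponent_eq_sum_openers)

variable {b c : ℕ}

/-! ### §1 Elementary values -/

/-- `2b ≤ 2(b+c)`. [folklore] -/
theorem two_mul_le (b c : ℕ) : 2 * b ≤ 2 * (b + c) := by omega

/-- Value of the right shift. [folklore] -/
@[simp] theorem val_shiftR (j : Fin (2 * c)) : (shiftR b c j : ℕ) = 2 * b + j := rfl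

/-- The right shift is injective. [folklore] -/
theorem shiftR_injective : Function.Injective (shiftR b c) := by
  intro j j' h
  have hv := congrArg Fin.val h
  rw [val_shiftR, val_shiftR] at hv
  exact Fin.ext (by omega)

/-- The right block embedding is injective. [folklore] -/
theorem blockEmbR_injective : Function.Injective (blockEmbR b c) :=
  shiftR_injective.prodMap shiftR_injective

/-- The right shift lands in the right block. [folklore] -/
theorem le_shiftR (j : Fin (2 * c)) : 2 * b ≤ (shiftR b c j : ℕ) := by
  rw [val_shiftR]; exact Nat.le_add_right _ _

/-- Every point is in the left block (a `castLE`) or in the right block (a `shiftR`). [folklore] -/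
theorem eq_castLE_or_eq_shiftR (i : Fin (2 * (b + c))) :
    (∃ j : Fin (2 * b), i = Fin.castLE (two_mul_le b c) j) ∨ ∃ j : Fin (2 * c), i = shiftR b c j := by
  by_cases hi : (i : ℕ) < 2 * b
  · exact Or.inl ⟨⟨i, hi⟩, Fin.ext rfl⟩
  · refine Or.inr ⟨⟨(i : ℕ) - 2 * b, by have := i.isLt; omega⟩, Fin.ext ?_⟩
    change (i : ℕ) = 2 * b + ((i : ℕ) - 2 * b)
    omega

/-- The gluing on the left block. [folklore] -/
theorem glue2_castLE (NL : Fin (2 * b) → Fin (2 * b)) (NR : Fin (2 * c) → Fin (2 * c)) (j : Fin (2 * b)) :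
    glue2 NL NR (Fin.castLE (two_mul_le b c) j) = Fin.castLE (two_mul_le b c) (NL j) := by
  have h : ((Fin.castLE (two_mul_le b c) j : Fin (2 * (b + c))) : ℕ) < 2 * b := by
    rw [Fin.val_castLE]; exact j.isLt
  unfold glue2
  rw [dif_pos h]
  rfl

/-- The gluing on the right block. [folklore] -/
theorem glue2_shiftR (NL : Fin (2 * b) → Fin (2 * b)) (NR : Fin (2 * c) → Fin (2 * c)) (j : Fin (2 * c)) :
    glue2 NL NR (shiftR b c j) = shiftR b c (NR j) := by
  have h : ¬ ((shiftR b c j : Fin (2 * (b + c))) : ℕ) < 2 * b := by rw [val_shiftR]; omega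
  have hj : (⟨((shiftR b c j : Fin (2 * (b + c))) : ℕ) - 2 * b, by have := (shiftR b c j).isLt; omega⟩ :
      Fin (2 * c)) = j := Fin.ext (by simp)
  unfold glue2
  rw [dif_neg h, hj]

/-- The gluing stabilises the left block. [folklore] -/
theorem glue2_stable (NL : Fin (2 * b) → Fin (2 * b)) (NR : Fin (2 * c) → Fin (2 * c)) :
    ∀ i : Fin (2 * (b + c)), (i : ℕ) < 2 * b → (glue2 NL NR i : ℕ) < 2 * b := by
  intro i hi
  rcases eq_castLE_or_eq_shiftR i with ⟨j, rfl⟩ | ⟨j, rfl⟩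
  · rw [glue2_castLE, Fin.val_castLE]; exact (NL j).isLt
  · rw [val_shiftR] at hi; omega

/-! ### §2 Weights in the left-internal direction -/

/-- **Weight in the left-internal direction** = number of arcs internal to the left block. [folklore] -/
theorem weight_eq_card (M : Fin (2 * (b + c)) → Fin (2 * (b + c))) :
    Finsupp.weight (lWeight b c) (arcExponent M) =
      ((openers M).filter fun i : Fin (2 * (b + c)) => (i : ℕ) < 2 * b ∧ (M i : ℕ) < 2 * b).card := by
  rw [weight_arcExponent_eq_sum_openers]
  simp only [lWeight]
  rw [Finset.sum_boole, Nat.cast_id]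

/-- The left block has `2b` points. [folklore] -/
theorem card_left : ((univ : Finset (Fin (2 * (b + c)))).filter fun i : Fin (2 * (b + c)) => (i : ℕ) < 2 * b).card = 2 * b := by
  rw [filter_lt_eq_map (two_mul_le b c), Finset.card_map, Finset.card_univ, Fintype.card_fin]

/-- For a perfect matching the internal openers and their partners are distinct points of the left block:
`2 · #internal arcs ≤ 2b`, with equality iff the matching STABILISES the left block. [folklore] -/
theorem two_mul_card_filter_le {M : Fin (2 * (b + c)) → Fin (2 * (b + c))} (hM : M ∈ perfectMatchings (2 * (b + c))) :
    2 * ((openers M).filter fun i : Fin (2 * (b + c)) => (i : ℕ) < 2 * b ∧ (M i : ℕ) < 2 * b).card ≤ 2 * b ∧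
    (2 * ((openers M).filter fun i : Fin (2 * (b + c)) => (i : ℕ) < 2 * b ∧ (M i : ℕ) < 2 * b).card = 2 * b ↔
      ∀ i : Fin (2 * (b + c)), (i : ℕ) < 2 * b → (M i : ℕ) < 2 * b) := by
  classical
  obtain ⟨hinv, hfp⟩ := mem_perfectMatchings.1 hM
  have hinj : Function.Injective M := Function.Involutive.injective hinv
  set O := (openers M).filter fun i : Fin (2 * (b + c)) => (i : ℕ) < 2 * b ∧ (M i : ℕ) < 2 * b with hO
  set Lset := (univ : Finset (Fin (2 * (b + c)))).filter fun i : Fin (2 * (b + c)) => (i : ℕ) < 2 * b with hL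
  have hcardL : Lset.card = 2 * b := card_left
  have hOL : O ⊆ Lset := fun i hi => by
    rw [hO, mem_filter] at hi
    rw [hL, mem_filter]
    exact ⟨mem_univ _, hi.2.1⟩
  have hML : O.image M ⊆ Lset := fun j hj => by
    rw [mem_image] at hj
    obtain ⟨i, hi, rfl⟩ := hj
    rw [hO, mem_filter] at hi
    rw [hL, mem_filter]
    exact ⟨mem_univ _, hi.2.2⟩
  have hdisj : Disjoint O (O.image M) := by
    rw [Finset.disjoint_left]
    intro j hj hj'
    rw [mem_image] at hj'
    obtain ⟨i, hi, rfl⟩ := hj'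
    rw [hO, mem_filter, mem_openers] at hi hj
    rw [hinv] at hj
    exact lt_asymm hi.1 hj.1
  have hcard : (O ∪ O.image M).card = 2 * O.card := by
    rw [card_union_of_disjoint hdisj, card_image_of_injective _ hinj]; ring
  have hUL : O ∪ O.image M ⊆ Lset := union_subset hOL hML
  have hA : 2 * O.card ≤ 2 * b := by
    rw [← hcard, ← hcardL]; exact card_le_card hUL
  refine ⟨hA, fun hEq => ?_, fun hst => ?_⟩
  · have hEq' : O ∪ O.image M = Lset := eq_of_subset_of_card_le hUL (by rw [hcard, hEq, hcardL])
    intro i hi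
    have hiL : i ∈ Lset := by rw [hL, mem_filter]; exact ⟨mem_univ _, hi⟩
    rw [← hEq', mem_union] at hiL
    rcases hiL with h | h
    · rw [hO, mem_filter] at h; exact h.2.2
    · rw [mem_image] at h
      obtain ⟨i', hi', rfl⟩ := h
      rw [hO, mem_filter] at hi'
      rw [hinv]
      exact hi'.2.1
  · have hLU : Lset ⊆ O ∪ O.image M := by
      intro j hj
      rw [hL, mem_filter] at hj
      rw [mem_union]
      by_cases hj' : j < M j
      · left
        rw [hO, mem_filter, mem_openers]
        exact ⟨hj', hj.2, hst j hj.2⟩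
      · right
        have hlt : M j < j := lt_of_le_of_ne (not_lt.1 hj') (hfp j)
        rw [mem_image]
        refine ⟨M j, ?_, hinv j⟩
        rw [hO, mem_filter, mem_openers, hinv]
        exact ⟨hlt, hst j hj.2, hj.2⟩
    have := card_le_card hLU
    rw [hcard, hcardL] at this
    omega

/-- **Upper bound**: every perfect matching weighs at most `b` in the left-internal direction. [folklore] -/
theorem weight_le {M : Fin (2 * (b + c)) → Fin (2 * (b + c))} (hM : M ∈ perfectMatchings (2 * (b + c))) :
    Finsupp.weight (lWeight b c) (arcExponent M) ≤ b := by
  rw [weight_eq_card]; have := (two_mul_card_filter_le hM).1; omega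

/-- **Equality case**: weight `b` iff the matching stabilises the left block. [folklore] -/
theorem weight_eq_iff {M : Fin (2 * (b + c)) → Fin (2 * (b + c))} (hM : M ∈ perfectMatchings (2 * (b + c))) :
    Finsupp.weight (lWeight b c) (arcExponent M) = b ↔
      ∀ i : Fin (2 * (b + c)), (i : ℕ) < 2 * b → (M i : ℕ) < 2 * b := by
  rw [weight_eq_card, ← (two_mul_card_filter_le hM).2]; omega

/-! ### §3 Restrictions and gluings -/

/-- A block-stable perfect matching also stabilises the right block. [folklore] -/
theorem stableR {M : Fin (2 * (b + c)) → Fin (2 * (b + c))} (hM : M ∈ perfectMatchings (2 * (b + c)))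
    (hst : ∀ i : Fin (2 * (b + c)), (i : ℕ) < 2 * b → (M i : ℕ) < 2 * b) :
    ∀ i : Fin (2 * (b + c)), 2 * b ≤ (i : ℕ) → 2 * b ≤ (M i : ℕ) := by
  intro i hi
  by_contra h
  have h' := hst (M i) (by omega)
  rw [(mem_perfectMatchings.1 hM).1 i] at h'
  omega

/-- Value of the right restriction on a map stabilising the right block. [folklore] -/
theorem add_val_restrictR {M : Fin (2 * (b + c)) → Fin (2 * (b + c))}
    (hstR : ∀ i : Fin (2 * (b + c)), 2 * b ≤ (i : ℕ) → 2 * b ≤ (M i : ℕ)) (j : Fin (2 * c)) :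
    2 * b + (restrictR b c M j : ℕ) = M (shiftR b c j) := by
  have := hstR (shiftR b c j) (le_shiftR j)
  show 2 * b + ((M (shiftR b c j) : ℕ) - 2 * b) = M (shiftR b c j)
  omega

/-- As `Fin`s: `shiftR (restrictR M j) = M (shiftR j)`. [folklore] -/
theorem shiftR_restrictR {M : Fin (2 * (b + c)) → Fin (2 * (b + c))}
    (hstR : ∀ i : Fin (2 * (b + c)), 2 * b ≤ (i : ℕ) → 2 * b ≤ (M i : ℕ)) (j : Fin (2 * c)) :
    shiftR b c (restrictR b c M j) = M (shiftR b c j) :=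
  Fin.ext (by rw [val_shiftR, add_val_restrictR hstR])

/-- As `Fin`s: `castLE (restrictM M j) = M (castLE j)`. [folklore] -/
theorem castLE_restrictM {M : Fin (2 * (b + c)) → Fin (2 * (b + c))}
    (hst : ∀ i : Fin (2 * (b + c)), (i : ℕ) < 2 * b → (M i : ℕ) < 2 * b) (j : Fin (2 * b)) :
    Fin.castLE (two_mul_le b c) (restrictM (two_mul_le b c) M j) = M (Fin.castLE (two_mul_le b c) j) :=
  Fin.ext (by rw [Fin.val_castLE, val_restrictM (two_mul_le b c) hst])

/-- The left restriction of a block-stable nest-free perfect matching is a nest-free perfect matching of `[0, 2b)`.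
[folklore] -/
theorem restrictM_mem' {M : Fin (2 * (b + c)) → Fin (2 * (b + c))} (hM : M ∈ nestFreeMatchings (2 * (b + c)))
    (hst : ∀ i : Fin (2 * (b + c)), (i : ℕ) < 2 * b → (M i : ℕ) < 2 * b) :
    restrictM (two_mul_le b c) M ∈ nestFreeMatchings (2 * b) := by
  have hPM := nestFreeMatchings_subset_perfectMatchings hM
  obtain ⟨hinv, hfp⟩ := mem_perfectMatchings.1 hPM
  have hnest := (mem_nestFreeMatchings.1 hM).2
  have hc := castLE_restrictM hst
  have hinjc := Fin.castLE_injective (two_mul_le b c)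
  rw [mem_nestFreeMatchings, mem_perfectMatchings]
  refine ⟨⟨fun j => hinjc ?_, fun j heq => ?_⟩, fun i j hij hj hji => ?_⟩
  · rw [hc, hc, hinv]
  · have h := hc j
    rw [heq] at h
    exact hfp _ h.symm
  · refine hnest (Fin.castLE (two_mul_le b c) i) (Fin.castLE (two_mul_le b c) j) ?_ ?_ ?_
    · exact (Fin.castLE_lt_castLE_iff _).2 hij
    · rw [← hc]; exact (Fin.castLE_lt_castLE_iff _).2 hj
    · rw [← hc, ← hc]; exact (Fin.castLE_lt_castLE_iff _).2 hji

/-- The right restriction of a block-stable nest-free perfect matching is a nest-free perfect matching of `[0, 2c)`.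
[folklore] -/
theorem restrictR_mem {M : Fin (2 * (b + c)) → Fin (2 * (b + c))} (hM : M ∈ nestFreeMatchings (2 * (b + c)))
    (hst : ∀ i : Fin (2 * (b + c)), (i : ℕ) < 2 * b → (M i : ℕ) < 2 * b) :
    restrictR b c M ∈ nestFreeMatchings (2 * c) := by
  have hPM := nestFreeMatchings_subset_perfectMatchings hM
  have hstR := stableR hPM hst
  obtain ⟨hinv, hfp⟩ := mem_perfectMatchings.1 hPM
  have hnest := (mem_nestFreeMatchings.1 hM).2
  have hs := shiftR_restrictR hstR
  have hlt : ∀ i j : Fin (2 * c), shiftR b c i < shiftR b c j ↔ i < j := fun i j => by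
    rw [Fin.lt_def, Fin.lt_def, val_shiftR, val_shiftR]; omega
  rw [mem_nestFreeMatchings, mem_perfectMatchings]
  refine ⟨⟨fun j => shiftR_injective (b := b) ?_, fun j heq => ?_⟩, fun i j hij hj hji => ?_⟩
  · rw [hs, hs, hinv]
  · have h := hs j
    rw [heq] at h
    exact hfp _ h.symm
  · refine hnest (shiftR b c i) (shiftR b c j) ((hlt _ _).2 hij) ?_ ?_
    · rw [← hs]; exact (hlt _ _).2 hj
    · rw [← hs, ← hs]; exact (hlt _ _).2 hji

/-- **The gluing of two nest-free perfect matchings is a nest-free perfect matching** (arcs in disjoint blocks never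
nest). [folklore] -/
theorem glue2_mem {NL : Fin (2 * b) → Fin (2 * b)} {NR : Fin (2 * c) → Fin (2 * c)}
    (hNL : NL ∈ nestFreeMatchings (2 * b)) (hNR : NR ∈ nestFreeMatchings (2 * c)) :
    glue2 NL NR ∈ nestFreeMatchings (2 * (b + c)) := by
  obtain ⟨hL, hLn⟩ := mem_nestFreeMatchings.1 hNL
  obtain ⟨hLi, hLf⟩ := mem_perfectMatchings.1 hL
  obtain ⟨hR, hRn⟩ := mem_nestFreeMatchings.1 hNR
  obtain ⟨hRi, hRf⟩ := mem_perfectMatchings.1 hR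
  have hlt : ∀ i j : Fin (2 * c), shiftR b c i < shiftR b c j ↔ i < j := fun i j => by
    rw [Fin.lt_def, Fin.lt_def, val_shiftR, val_shiftR]; omega
  rw [mem_nestFreeMatchings, mem_perfectMatchings]
  refine ⟨⟨fun i => ?_, fun i => ?_⟩, fun i i' h1 h2 h3 => ?_⟩
  · rcases eq_castLE_or_eq_shiftR i with ⟨j, rfl⟩ | ⟨j, rfl⟩
    · rw [glue2_castLE, glue2_castLE, hLi]
    · rw [glue2_shiftR, glue2_shiftR, hRi]
  · rcases eq_castLE_or_eq_shiftR i with ⟨j, rfl⟩ | ⟨j, rfl⟩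
    · rw [glue2_castLE]; exact fun h => hLf j (Fin.castLE_injective _ h)
    · rw [glue2_shiftR]; exact fun h => hRf j (shiftR_injective h)
  · rcases eq_castLE_or_eq_shiftR i with ⟨j, rfl⟩ | ⟨j, rfl⟩ <;>
      rcases eq_castLE_or_eq_shiftR i' with ⟨j', rfl⟩ | ⟨j', rfl⟩
    · rw [glue2_castLE] at h2 h3
      rw [glue2_castLE] at h3
      exact hLn j j' ((Fin.castLE_lt_castLE_iff _).1 h1) ((Fin.castLE_lt_castLE_iff _).1 h2)
        ((Fin.castLE_lt_castLE_iff _).1 h3)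
    · rw [glue2_castLE, glue2_shiftR, Fin.lt_def, val_shiftR, Fin.val_castLE] at h3
      have := (NL j).isLt
      omega
    · rw [Fin.lt_def, val_shiftR, Fin.val_castLE] at h1
      have := j'.isLt
      omega
    · rw [glue2_shiftR] at h2 h3
      rw [glue2_shiftR] at h3
      exact hRn j j' ((hlt _ _).1 h1) ((hlt _ _).1 h2) ((hlt _ _).1 h3)

/-- Left restriction of a gluing. [folklore] -/
theorem restrictM_glue2 (NL : Fin (2 * b) → Fin (2 * b)) (NR : Fin (2 * c) → Fin (2 * c)) :
    restrictM (two_mul_le b c) (glue2 NL NR) = NL := by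
  funext j
  apply Fin.castLE_injective (two_mul_le b c)
  rw [castLE_restrictM (glue2_stable NL NR), glue2_castLE]

/-- Right restriction of a gluing. [folklore] -/
theorem restrictR_glue2 (NL : Fin (2 * b) → Fin (2 * b)) (NR : Fin (2 * c) → Fin (2 * c)) :
    restrictR b c (glue2 NL NR) = NR := by
  funext j
  apply Fin.ext
  show ((glue2 NL NR (shiftR b c j) : Fin (2 * (b + c))) : ℕ) - 2 * b = NR j
  rw [glue2_shiftR, val_shiftR]
  omega

/-- A block-stable perfect matching IS the gluing of its two restrictions. [folklore] -/
theorem glue2_restrict {M : Fin (2 * (b + c)) → Fin (2 * (b + c))} (hM : M ∈ perfectMatchings (2 * (b + c)))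
    (hst : ∀ i : Fin (2 * (b + c)), (i : ℕ) < 2 * b → (M i : ℕ) < 2 * b) :
    glue2 (restrictM (two_mul_le b c) M) (restrictR b c M) = M := by
  have hstR := stableR hM hst
  funext i
  rcases eq_castLE_or_eq_shiftR i with ⟨j, rfl⟩ | ⟨j, rfl⟩
  · rw [glue2_castLE, castLE_restrictM hst]
  · rw [glue2_shiftR, shiftR_restrictR hstR]

end Summit.ValiantsHypothesis.ValiantsHypothesis.Theorems.FifoMatching.NNDivisionHard.SplitFace

end
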